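import Summits.Ventures.YMGap.Census.MarkedPlaquetteTransport
import HarnessLib

/-!
# Venture YMGap, track (b) — reflection positivity for INHOMOGENEOUS (plaquette-dependent) character
# coefficient fields that are mirror-symmetric off the reflection hyperplanes

HONEST FRAMING: venture file of the cell `pub-ymgap` (QuantumFields programme), track (b); finite tori `(ℤ/Lℤ)^d`,
`L` even; nothing about Tomboulis's (5.15), limits, confinement or a mass gap.

`CrossingWeightRP.crossIntegral_nonneg` proves `0 ≤ ∫ ∏_p w_p(U_p) dU` when the non-crossing plaquettes all carry the
SAME plaquette function `f_c` and the crossing ones arbitrary non-negative character sums.  Tomboulis's App. A §1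
(arXiv:0707.2179, (A.1)–(A.4): "dropping … all the plaquettes bisected by `π₁`, all non-negative by reflection
positivity", then iterating on sub-lattices) needs the same positivity for INHOMOGENEOUS couplings: a character
coefficient FIELD `a : plaquettes → (n ↦ a_{p,n})`, weight `w_p = Σ_{n ≤ J} a_{p,n} χ_n(U_p)`, which is only required to be
MIRROR-SYMMETRIC off the reflection hyperplanes, `a_{ϑp} = a_p` for non-crossing `p` (`WilsonRP.plaqReflect`), and
non-negative on the crossing plaquettes.  This file records that statement (`coefFieldZ_nonneg`, the Osterwalder–Seiler
argument of `CharacterTwistBound` verbatim: split `G(U) G(ΘU) W_×(U)`, Haar substitution `translate Y`, every character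
kernel an integral Gram form by the `LatticeQCDFlow` convolution identity, Fubini,
`LatticeRP.integral_splice_mul_conj_comp_nonneg`), the dictionary `torusZ = coefFieldZ (uniform field)`, and the
invariance of the field partition function under the lattice symmetries used for transport (translations
`configShift` / `plaqShift` of `MarkedPlaquetteTransport`, transpositions `configTranspose` / `plaqTranspose`).

## Main statements (namespace `Summit.Ventures.YMGap.Census`)

* `coefFieldFn J a W = ∏_p charSum J (a p) (Re tr U_p)`, `coefFieldZ J a = ∫ coefFieldFn`; `torusZ_eq_coefFieldZ`.
* `coefFieldZ_nonneg` — `L` even, `a_{ϑp} = a_p` for non-crossing `p`, `a_p ≥ 0` for crossing `p` ⟹ `0 ≤ coefFieldZ J a`.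
* `coefFieldZ_comp_plaqShift`, `coefFieldZ_comp_plaqTranspose` — relabelling the field along a lattice symmetry does
  not change the partition function.

References: E. T. Tomboulis, arXiv:0707.2179, App. A §1 eqs. (A.1)–(A.4) [cite: Tomboulis2007Confinement, App. A §1];
K. Osterwalder, E. Seiler, Ann. Phys. 110 (1978) 440, §2 [cite: OsterwalderSeilerAnnPhys1978, §2].
-/

noncomputable section

open MeasureTheory Finset Real
open scoped BigOperators
open Literature.MathematicalPhysics.QuantumLattice
open Literature.MathematicalPhysics.QuantumFieldTheory
open Literature.MathematicalPhysics.QuantumFieldTheory.Tomboulis2007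
open Literature.MathematicalPhysics.QuantumFieldTheory.WilsonRP
open Summit.Ventures.LatticeQCDFlow.Exactness

namespace Summit.Ventures.YMGap.Census

variable {d L : ℕ}

/-! ### Character coefficient fields and their partition function -/

/-- The integrand of the field partition function: `∏_p Σ_{n ≤ J} a_{p,n} χ_n(U_p)`. -/
def coefFieldFn [NeZero L] (J : ℕ) (a : Plaquette d L → ℕ → ℝ) (W : GaugeConfig d L SU2) : ℝ :=
  ∏ p, charSum J (a p) (plaqRe rhoFund W p)

/-- **The partition function of a character coefficient field** `a : p ↦ (a_{p,n})_n`: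
`Z(a) = ∫ ∏_p Σ_{n ≤ J} a_{p,n} χ_n(U_p) ∏_b dU_b` (inhomogeneous couplings; Tomboulis's `Z_Λ({c_j})` is the uniform
field `a_p = stdCoef c`, `torusZ_eq_coefFieldZ`). -/
def coefFieldZ [NeZero L] (J : ℕ) (a : Plaquette d L → ℕ → ℝ) : ℝ :=
  ∫ W, coefFieldFn J a W ∂(LatticeRP.piMeasure (haarProbability SU2))

/-- **Dictionary**: `Z_Λ({c_j}) = Z(uniform field stdCoef c)`. -/
theorem torusZ_eq_coefFieldZ [NeZero L] (J : ℕ) (c : ℕ → ℝ) :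
    torusZ d L J c = coefFieldZ J (fun _ : Plaquette d L => stdCoef c) := by
  unfold torusZ coefFieldZ coefFieldFn
  refine integral_congr_ae (ae_of_all _ fun W => Finset.prod_congr rfl fun p _ => ?_)
  rw [plaqFn_hol_eq_fR, charSum_stdCoef]

/-- `coefFieldFn` is continuous in the configuration. -/
theorem continuous_coefFieldFn [NeZero L] (J : ℕ) (a : Plaquette d L → ℕ → ℝ) :
    Continuous (coefFieldFn (d := d) (L := L) J a) :=
  continuous_finsetProd _ fun p _ => (continuous_charSum J (a p)).comp (continuous_plaqRe p)

/-- If the coefficient vector of one plaquette vanishes, so does the field partition function. -/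
theorem coefFieldZ_eq_zero_of_apply_eq_zero [NeZero L] (J : ℕ) {a : Plaquette d L → ℕ → ℝ} {p₀ : Plaquette d L}
    (h : a p₀ = 0) : coefFieldZ J a = 0 := by
  unfold coefFieldZ
  have hz : ∀ W : GaugeConfig d L SU2, coefFieldFn J a W = 0 := fun W => by
    unfold coefFieldFn
    refine Finset.prod_eq_zero (Finset.mem_univ p₀) ?_
    simp [charSum, h]
  simp_rw [hz, integral_zero]

section RP

variable [NeZero d] [NeZero L] [Fact (1 < L)]

/-! ### The split into positive, reflected and crossing plaquettes for a mirror-symmetric field -/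

/-- The positive-time part `G(W) = ∏_{p positive} w_p(U_p)`. -/
def gPosF (J : ℕ) (a : Plaquette d L → ℕ → ℝ) (W : GaugeConfig d L SU2) : ℝ :=
  ∏ p ∈ univ.filter IsPosPlaq, charSum J (a p) (plaqRe rhoFund W p)

/-- `∏_{p negative} φ_p(Re tr U_p) = ∏_{p positive} φ_{ϑp}(Re tr (ΘU)_p)` for plaquette-dependent `φ`
(`plaqRe_timeReflect`, `plaqReflectEquiv`). -/
theorem prod_neg_eq_prod_pos_timeReflect_dep (hL : Even L) (φ : Plaquette d L → ℝ → ℝ)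
    (W : GaugeConfig d L SU2) :
    ∏ p ∈ univ.filter IsNegPlaq, φ p (plaqRe rhoFund W p) =
      ∏ p ∈ univ.filter IsPosPlaq, φ (plaqReflect p) (plaqRe rhoFund W.timeReflect p) := by
  simp_rw [plaqRe_timeReflect rhoFund (continuous_fundamentalRep (Fin 2))]
  symm
  refine Finset.prod_equiv plaqReflectEquiv (fun p => ?_) (fun p _ => rfl)
  simp only [Finset.mem_filter, Finset.mem_univ, true_and]
  exact (isNegPlaq_plaqReflect_iff hL p).symm

/-- **`∏_p w_p(U) = G(U) · G(ΘU) · ∏_{p crossing} w_p(U_p)`** for a field mirror-symmetric off the crossing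
plaquettes. -/
theorem prod_coefField_split (hL : Even L) (J : ℕ) {a : Plaquette d L → ℕ → ℝ}
    (ha : ∀ p, ¬ IsCrossPlaq p → a (plaqReflect p) = a p) (W : GaugeConfig d L SU2) :
    coefFieldFn J a W =
      gPosF J a W * gPosF J a W.timeReflect *
        ∏ p ∈ univ.filter IsCrossPlaq, charSum J (a p) (plaqRe rhoFund W p) := by
  unfold coefFieldFn
  rw [← Finset.prod_filter_mul_prod_filter_not univ IsCrossPlaq, mul_comm]
  unfold gPosF
  congr 1
  rw [← Finset.prod_filter_mul_prod_filter_not (univ.filter fun p => ¬ IsCrossPlaq p) IsPosPlaq,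
    Finset.filter_filter, Finset.filter_filter]
  have hpos : univ.filter (fun p : Plaquette d L => ¬ IsCrossPlaq p ∧ IsPosPlaq p) = univ.filter IsPosPlaq :=
    Finset.filter_congr fun p _ =>
      ⟨fun h => h.2, fun h => ⟨fun hc => not_isPosPlaq_of_isCrossPlaq hL hc h, h⟩⟩
  have hneg : univ.filter (fun p : Plaquette d L => ¬ IsCrossPlaq p ∧ ¬ IsPosPlaq p) =
      univ.filter IsNegPlaq :=
    Finset.filter_congr fun p _ => ⟨fun h => ⟨h.2, h.1⟩, fun h => ⟨h.2, h.1⟩⟩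
  rw [hpos, hneg, prod_neg_eq_prod_pos_timeReflect_dep hL (fun p r => charSum J (a p) r) W]
  congr 1
  refine Finset.prod_congr rfl fun p hp => ?_
  have hneg' : IsNegPlaq (plaqReflect p) := (isNegPlaq_plaqReflect_iff hL p).2 (Finset.mem_filter.1 hp).2
  have h := ha (plaqReflect p) hneg'.2
  rw [plaqReflect_plaqReflect] at h
  rw [← h]

/-! ### The Gram expansion (reusing `wCrossA_translate`) with the field weight `G` -/

omit [NeZero L] [Fact (1 < L)] in
/-- The Gram weights are non-negative when the field is non-negative on the crossing plaquettes. -/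
theorem gWtA_nonneg_of_cross {a : Plaquette d L → ℕ → ℝ} (ha : ∀ p, IsCrossPlaq p → ∀ n, 0 ≤ a p n)
    (p : Plaquette d L) (n : ℕ) : 0 ≤ gWtA a p n := by
  unfold gWtA
  split_ifs with hp
  · exact mul_nonneg (ha p hp n) (by positivity)
  · exact zero_le_one
  · exact le_rfl

/-- `Φ_{x,R⃗}(W) = G(W) ∏_p feat_{p, x_p}(R⃗_p, W)` with the field weight. -/
def PhiF (J : ℕ) (a : Plaquette d L → ℕ → ℝ) (x : Plaquette d L → ℕ) (Rv : Plaquette d L → SU2)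
    (W : GaugeConfig d L SU2) : ℝ :=
  gPosF J a W * ∏ p, feat p (x p) (Rv p) W

/-- The tripled integrand `M((U, Y), R⃗) = Σ_x Γ_x Φ_{x,R⃗}(splice_C(U, Y)) Φ_{x,R⃗}(ΘU)`. -/
def MintF (J : ℕ) (a : Plaquette d L → ℕ → ℝ)
    (q : GaugeConfig d L SU2 × GaugeConfig d L SU2) (Rv : Plaquette d L → SU2) : ℝ :=
  ∑ x ∈ Fintype.piFinset (fun _ : Plaquette d L => Finset.range (J + 1)),
    (∏ p, gWtA a p (x p)) *
      (PhiF J a x Rv (LatticeRP.splice crossEdges q) * PhiF J a x Rv (GaugeConfig.timeReflect q.1))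

/-- `G` depends only on the positive links. -/
theorem gPosF_congr (J : ℕ) (a : Plaquette d L → ℕ → ℝ) {A B : GaugeConfig d L SU2}
    (hAB : ∀ e ∈ ((posEdges : Finset (Edge d L)) : Set (Edge d L)), A e = B e) :
    gPosF J a A = gPosF J a B := by
  unfold gPosF
  refine Finset.prod_congr rfl fun p hp => ?_
  have hpos : IsPosPlaq p := (Finset.mem_filter.mp hp).2
  obtain ⟨h1, h2, h3, h4⟩ := isPosEdge_of_isPosPlaq hpos
  have h : ∀ e, IsPosEdge e → A e = B e := fun e he => hAB e (by simpa using he)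
  simp only [plaqRe, plaquetteHolonomy, h _ h1, h _ h2, h _ h3, h _ h4]

omit [Fact (1 < L)] in
/-- `G` is continuous. -/
theorem continuous_gPosF (J : ℕ) (a : Plaquette d L → ℕ → ℝ) : Continuous (gPosF (d := d) (L := L) J a) := by
  unfold gPosF
  exact continuous_finsetProd _ fun p _ => (continuous_charSum J (a p)).comp (continuous_plaqRe p)

omit [Fact (1 < L)] in
/-- `Φ_{x,R⃗}(W)` is jointly continuous along continuous maps `z ↦ (F z, R⃗(z))`. -/
theorem continuous_PhiF_comp (J : ℕ) (a : Plaquette d L → ℕ → ℝ) (x : Plaquette d L → ℕ) {X : Type*}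
    [TopologicalSpace X] {F : X → GaugeConfig d L SU2} {Rf : X → Plaquette d L → SU2} (hF : Continuous F)
    (hR : Continuous Rf) : Continuous fun z : X => PhiF J a x (Rf z) (F z) := by
  unfold PhiF
  have hG : Continuous fun z : X => gPosF J a (F z) := (continuous_gPosF J a).comp hF
  have hP : Continuous fun z : X => ∏ p, feat p (x p) (Rf z p) (F z) :=
    continuous_finsetProd _ fun p _ => continuous_feat_comp p (x p) hF ((continuous_apply p).comp hR)
  exact hG.mul hP

omit [Fact (1 < L)] in
/-- `z ↦ Φ_{x,R⃗(z)}(F z) Φ_{x,R⃗(z)}(G z)` is continuous. -/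
theorem continuous_PhiF_mul (J : ℕ) (a : Plaquette d L → ℕ → ℝ) (x : Plaquette d L → ℕ) {X : Type*}
    [TopologicalSpace X] {F G : X → GaugeConfig d L SU2} {Rf : X → Plaquette d L → SU2} (hF : Continuous F)
    (hG : Continuous G) (hR : Continuous Rf) :
    Continuous fun z : X => PhiF J a x (Rf z) (F z) * PhiF J a x (Rf z) (G z) :=
  (continuous_PhiF_comp J a x hF hR).mul (continuous_PhiF_comp J a x hG hR)

omit [Fact (1 < L)] in
/-- The tripled integrand is jointly continuous. -/
theorem continuous_MintF (J : ℕ) (a : Plaquette d L → ℕ → ℝ) :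
    Continuous (Function.uncurry (MintF (d := d) (L := L) J a)) := by
  have h : Function.uncurry (MintF (d := d) (L := L) J a) =
      fun z => ∑ x ∈ Fintype.piFinset (fun _ : Plaquette d L => Finset.range (J + 1)),
        (∏ p, gWtA a p (x p)) *
          (PhiF J a x z.2 (LatticeRP.splice crossEdges z.1) * PhiF J a x z.2 (GaugeConfig.timeReflect z.1.1)) := by
    funext z
    rfl
  rw [h]
  refine continuous_finsetSum _ fun x _ => ?_
  have h1 : Continuous fun z : (GaugeConfig d L SU2 × GaugeConfig d L SU2) × (Plaquette d L → SU2) =>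
      PhiF J a x z.2 (LatticeRP.splice crossEdges z.1) :=
    continuous_PhiF_comp J a x ((continuous_splice crossEdges).comp continuous_fst) continuous_snd
  have h2 : Continuous fun z : (GaugeConfig d L SU2 × GaugeConfig d L SU2) × (Plaquette d L → SU2) =>
      PhiF J a x z.2 (GaugeConfig.timeReflect z.1.1) :=
    continuous_PhiF_comp J a x (continuous_timeReflect.comp (continuous_fst.comp continuous_fst))
      continuous_snd
  exact continuous_const.mul (h1.mul h2)

/-- `Φ_{x,R⃗}` depends only on the links in `P ∪ C`. -/
theorem dependsOn_PhiF (hL : Even L) (J : ℕ) (a : Plaquette d L → ℕ → ℝ) (x : Plaquette d L → ℕ)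
    (Rv : Plaquette d L → SU2) :
    DependsOn (PhiF J a x Rv) ((posEdges ∪ crossEdges : Finset (Edge d L)) : Set (Edge d L)) := by
  intro A B hAB
  have hP : ∀ e ∈ ((posEdges : Finset (Edge d L)) : Set (Edge d L)), A e = B e := fun e he =>
    hAB e (by rw [Finset.coe_union]; exact Or.inl he)
  unfold PhiF
  rw [gPosF_congr J a hP, Finset.prod_congr rfl fun p _ => feat_congr hL p (x p) (Rv p) hAB]

/-- **The pointwise identity** after `translate Y`: `∏_p w_p(translate Y U) = ∫ M((U, Y), R⃗) dR⃗`. -/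
theorem coefFieldFn_translate (hL : Even L) (J : ℕ) {a : Plaquette d L → ℕ → ℝ}
    (ha : ∀ p, ¬ IsCrossPlaq p → a (plaqReflect p) = a p) (W Y : GaugeConfig d L SU2) :
    coefFieldFn J a (translate Y W) =
      ∫ Rv, MintF J a (W, Y) Rv ∂(Measure.pi fun _ : Plaquette d L => haarProbability SU2) := by
  haveI : SecondCountableTopology SU2 := secondCountableTopology_su2
  have hPC : ∀ e : Edge d L, IsPosEdge e → ¬ IsCrossEdge e :=
    fun e he hc => not_isPosEdge_of_isCrossEdge hL hc he
  have hmem : ∀ e : Edge d L, e ∈ ((posEdges : Finset (Edge d L)) : Set (Edge d L)) → IsPosEdge e :=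
    fun e he => by simpa using he
  have htr : ∀ e ∈ ((posEdges : Finset (Edge d L)) : Set (Edge d L)), translate Y W e = W e :=
    fun e he => translate_apply_of_not_isCrossEdge Y W (hPC e (hmem e he))
  have hsp : ∀ e ∈ ((posEdges : Finset (Edge d L)) : Set (Edge d L)),
      LatticeRP.splice crossEdges (W, Y) e = W e :=
    fun e he => splice_apply_of_not_isCrossEdge W Y (hPC e (hmem e he))
  have hΘtr : ∀ e ∈ ((posEdges : Finset (Edge d L)) : Set (Edge d L)),
      (translate Y W).timeReflect e = W.timeReflect e := by
    intro e he
    rw [timeReflect_apply, timeReflect_apply,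
      translate_apply_of_not_isCrossEdge Y W (not_isCrossEdge_edgeReflect hL (hmem e he))]
  have hG1 : gPosF J a (translate Y W) = gPosF J a (LatticeRP.splice crossEdges (W, Y)) := by
    rw [gPosF_congr J a htr, ← gPosF_congr J a hsp]
  have hG2 : gPosF J a (translate Y W).timeReflect = gPosF J a W.timeReflect := gPosF_congr J a hΘtr
  rw [prod_coefField_split hL J ha, wCrossA_translate hL J a W Y, hG1, hG2, Finset.mul_sum]
  unfold MintF
  rw [integral_finsetSum _ (fun x _ =>
    (integrable_of_continuous_fin (continuous_PhiF_mul J a x (F := fun _ => LatticeRP.splice crossEdges (W, Y))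
      (G := fun _ => W.timeReflect) (Rf := fun Rv => Rv) continuous_const continuous_const
      continuous_id)).const_mul _)]
  refine Finset.sum_congr rfl fun x _ => ?_
  rw [← integral_const_mul, ← integral_const_mul]
  refine integral_congr_ae (ae_of_all _ fun Rv => ?_)
  set A := ∏ p, feat p (x p) (Rv p) (LatticeRP.splice crossEdges (W, Y)) with hA
  set B := ∏ p, feat p (x p) (Rv p) W.timeReflect with hB
  simp only [PhiF, ← hA, ← hB]
  ring

/-- **Positivity of the inner double integral** for every auxiliary configuration `R⃗`. -/
theorem innerF_nonneg (hL : Even L) (J : ℕ) {a : Plaquette d L → ℕ → ℝ}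
    (hpos : ∀ p, IsCrossPlaq p → ∀ n, 0 ≤ a p n) (Rv : Plaquette d L → SU2) :
    0 ≤ ∫ q, MintF J a q Rv
      ∂((LatticeRP.piMeasure (haarProbability SU2)).prod (LatticeRP.piMeasure (haarProbability SU2))) := by
  haveI : SecondCountableTopology SU2 := secondCountableTopology_su2
  unfold MintF
  rw [integral_finsetSum _ (fun x _ =>
    (integrable_of_continuous_fin (continuous_PhiF_mul J a x (F := LatticeRP.splice crossEdges)
      (G := fun q => GaugeConfig.timeReflect q.1) (Rf := fun _ => Rv) (continuous_splice crossEdges)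
      (continuous_timeReflect.comp continuous_fst) continuous_const)).const_mul _)]
  refine Finset.sum_nonneg fun x _ => ?_
  rw [integral_const_mul]
  refine mul_nonneg (Finset.prod_nonneg fun p _ => gWtA_nonneg_of_cross hpos p (x p)) ?_
  exact rp_term_nonneg hL (Φ := PhiF J a x Rv)
    (continuous_PhiF_comp J a x (F := fun W => W) (Rf := fun _ => Rv) continuous_id continuous_const)
    (dependsOn_PhiF hL J a x Rv)

/-- **Reflection positivity for a mirror-symmetric coefficient field** (Tomboulis's App. A §1 step "all
non-negative by reflection positivity", inhomogeneous form): on the even torus, if `a_{ϑp} = a_p` for every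
non-crossing plaquette `p` and `a_{p,n} ≥ 0` on the crossing plaquettes, then
`0 ≤ ∫ ∏_p Σ_n a_{p,n} χ_n(U_p) dU`. -/
theorem coefFieldZ_nonneg (hL : Even L) (J : ℕ) {a : Plaquette d L → ℕ → ℝ}
    (ha : ∀ p, ¬ IsCrossPlaq p → a (plaqReflect p) = a p) (hpos : ∀ p, IsCrossPlaq p → ∀ n, 0 ≤ a p n) :
    0 ≤ coefFieldZ J a := by
  haveI : SecondCountableTopology SU2 := secondCountableTopology_su2
  have hHc := continuous_coefFieldFn (d := d) (L := L) J a
  have step1 : coefFieldZ J a =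
      ∫ Y, ∫ W, coefFieldFn J a (WilsonRP.translate Y W)
        ∂(LatticeRP.piMeasure (haarProbability SU2)) ∂(LatticeRP.piMeasure (haarProbability SU2)) := by
    unfold coefFieldZ
    simp_rw [integral_comp_translate _ hHc, integral_const, probReal_univ, one_smul]
  have step2 : ∀ Y W : GaugeConfig d L SU2, coefFieldFn J a (WilsonRP.translate Y W) =
      ∫ Rv, MintF J a (W, Y) Rv ∂(Measure.pi fun _ : Plaquette d L => haarProbability SU2) :=
    fun Y W => coefFieldFn_translate hL J ha W Y
  have hMi : Integrable (Function.uncurry (MintF J a))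
      (((LatticeRP.piMeasure (haarProbability SU2)).prod (LatticeRP.piMeasure (haarProbability SU2))).prod
        (Measure.pi fun _ : Plaquette d L => haarProbability SU2)) :=
    integrable_of_continuous_fin (continuous_MintF J a)
  rw [step1]
  simp_rw [step2]
  rw [← integral_prod_symm (fun q => ∫ Rv, MintF J a q Rv
      ∂(Measure.pi fun _ : Plaquette d L => haarProbability SU2)) hMi.integral_prod_left,
    integral_integral_swap hMi]
  exact integral_nonneg fun Rv => innerF_nonneg hL J hpos Rv

end RP

/-! ### Invariance of the field partition function under lattice translations and transpositions -/

section Transport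

variable [NeZero L]

omit [NeZero L] in
/-- `Re tr` of a translated configuration: `Re tr (U ∘ shift_v)_p = Re tr U_{p + v}`. -/
theorem plaqRe_configShift (v : Site d L) (W : GaugeConfig d L SU2) (p : Plaquette d L) :
    plaqRe rhoFund (configShift v W) p = plaqRe rhoFund W (plaqShift v p) := by
  simp only [plaqRe, plaquetteHolonomy_configShift, plaqShift]

/-- The field integrand intertwines translations. -/
theorem coefFieldFn_configShift (J : ℕ) (a : Plaquette d L → ℕ → ℝ) (v : Site d L) (W : GaugeConfig d L SU2) :
    coefFieldFn J (fun p => a (plaqShift v p)) (configShift v W) = coefFieldFn J a W := by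
  unfold coefFieldFn
  simp only [plaqRe_configShift]
  exact Fintype.prod_equiv (plaqShiftEquiv v) _ _ fun p => by rw [plaqShiftEquiv_apply]

/-- **Translation invariance**: relabelling the field along a lattice translation does not change `Z`. -/
theorem coefFieldZ_comp_plaqShift (J : ℕ) (a : Plaquette d L → ℕ → ℝ) (v : Site d L) :
    coefFieldZ J (fun p => a (plaqShift v p)) = coefFieldZ J a := by
  unfold coefFieldZ
  rw [← (measurePreserving_configShiftEquiv (haarProbability SU2) v).integral_comp'
    (coefFieldFn J fun p => a (plaqShift v p))]
  refine integral_congr_ae (ae_of_all _ fun W => ?_)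
  simp only [configShiftEquiv_apply, coefFieldFn_configShift]

omit [NeZero L] in
/-- `Re tr` inside a transposed configuration: a function of `Re tr` does not see the orientation reversal. -/
theorem plaqRe_configTranspose (μ ν : Fin d) (W : GaugeConfig d L SU2) (p : Plaquette d L) :
    plaqRe rhoFund (configTranspose μ ν W) p = plaqRe rhoFund W (plaqTranspose μ ν p) := by
  have h := apply_hol_configTranspose (G := SU2) (fun U : SU2 => ((rhoFund U).trace).re)
    (fun U => Literature.RepresentationTheory.CompactGroups.CompactGroup.re_trace_map_inv rhoFund
      (continuous_fundamentalRep (Fin 2)) U) μ ν W p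
  simpa only [plaqRe] using h

/-- The field integrand intertwines transpositions. -/
theorem coefFieldFn_configTranspose (J : ℕ) (a : Plaquette d L → ℕ → ℝ) (μ ν : Fin d)
    (W : GaugeConfig d L SU2) :
    coefFieldFn J (fun p => a (plaqTranspose μ ν p)) (configTranspose μ ν W) = coefFieldFn J a W := by
  unfold coefFieldFn
  simp only [plaqRe_configTranspose]
  exact Fintype.prod_equiv (plaqTransposeEquiv μ ν) _ _ fun p => rfl

/-- **Transposition invariance**: relabelling the field along a transposition of the axes does not change `Z`. -/
theorem coefFieldZ_comp_plaqTranspose (J : ℕ) (a : Plaquette d L → ℕ → ℝ) (μ ν : Fin d) :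
    coefFieldZ J (fun p => a (plaqTranspose μ ν p)) = coefFieldZ J a := by
  unfold coefFieldZ
  rw [← (measurePreserving_configTransposeEquiv (G := SU2) μ ν).integral_comp'
    (coefFieldFn J fun p => a (plaqTranspose μ ν p))]
  refine integral_congr_ae (ae_of_all _ fun W => ?_)
  simp only [configTransposeEquiv_apply, coefFieldFn_configTranspose]

end Transport

end Summit.Ventures.YMGap.Census

end
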